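import Summits.Ventures.Crystal3D.StickySpheres.TetraFan
import HarnessLib

/-!
# The prism link is not a contact graph

Venture `Crystal3D` (cell `pub-crystal3d`, seat p2). Elementary Euclidean geometry in `ℝ³` (unit DIAMETER convention): a
ball `h` cannot touch six balls `a, b, c, a', b', c'` with `a, b, c` mutually touching, `a', b', c'` mutually touching and
`a a'`, `b b'`, `c c'` touching (the link of `h` would be the triangular prism graph). Seen from `h` these are two regular
tetrahedral tripods of unit vectors matched by three contacts; writing the primed vectors in the basis `a, b, c`
(`eq_zero_of_inner_tripod`), the six unknown inner products `s₁ = ⟪a',b⟫, t₁ = ⟪a',c⟫, s₂ = ⟪b',a⟫, t₂ = ⟪b',c⟫,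
s₃ = ⟪c',a⟫, t₃ = ⟪c',b⟫` satisfy six quadratic equations (three unit norms, three contacts), while non-overlap and
Cauchy–Schwarz confine each to `[−1, 1/2]`. These are jointly infeasible: a degree-three Positivstellensatz (Handelman)
certificate — linear multiples of the six equations plus a non-negative combination of 36 products of three box constraints
summing to `−1` — was found by linear programming (exact rational arithmetic) and is discharged here by `linarith` given the
36 products. (The equations alone ARE solvable, e.g. `a' = b, b' = c, c' = a`; every real solution has a coordinate equal to
`1`, i.e. two coincident balls; and the prism link IS realisable in `ℝ⁴`, so dimension three is essential — it enters
through the basis expansion.) This is the seven-vertex fifteen-edge graph `FUxvw`, the last of the two `K₅`/`K_{3,3}`-free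
fifteen-edge graphs on seven vertices that are not contact graphs (the other is `TetraFan.lean`).

HONEST FRAMING: folklore solid geometry with a computer-found, kernel-checked algebraic certificate; nothing enumerative and
nothing about crystallization is claimed.
-/

noncomputable section

open Real RealInnerProductSpace

namespace Summit.Ventures.Crystal3D

/-- Five of the six polynomial relations (unit norms of `a', c'` and the contacts `a'b', a'c', b'c'`, in tripod
coordinates) already have no solution in the box `[−1, 1/2]⁶`: a degree-three Handelman certificate, checked by `linarith`.
[folklore] -/
theorem prism_algebra (s₁ t₁ s₂ t₂ s₃ t₃ : ℝ)
    (E1 : 2 * ((1 / 2) ^ 2 + s₁ ^ 2 + t₁ ^ 2) - (1 / 2) * (1 / 2 + s₁ + t₁) ^ 2 - 1 = 0)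
    (E3 : 2 * (s₃ ^ 2 + t₃ ^ 2 + (1 / 2) ^ 2) - (1 / 2) * (s₃ + t₃ + 1 / 2) ^ 2 - 1 = 0)
    (E4 : 2 * (1 / 2 * s₂ + s₁ * (1 / 2) + t₁ * t₂) - (1 / 2) * (1 / 2 + s₁ + t₁) * (s₂ + 1 / 2 + t₂) - 1 / 2 = 0)
    (E5 : 2 * (1 / 2 * s₃ + s₁ * t₃ + t₁ * (1 / 2)) - (1 / 2) * (1 / 2 + s₁ + t₁) * (s₃ + t₃ + 1 / 2) - 1 / 2 = 0)
    (E6 : 2 * (s₂ * s₃ + 1 / 2 * t₃ + t₂ * (1 / 2)) - (1 / 2) * (s₂ + 1 / 2 + t₂) * (s₃ + t₃ + 1 / 2) - 1 / 2 = 0)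
    (h₁ : s₁ ≤ 1 / 2) (h₂ : t₁ ≤ 1 / 2) (h₃ : s₂ ≤ 1 / 2) (h₄ : t₂ ≤ 1 / 2) (h₅ : s₃ ≤ 1 / 2) (h₆ : t₃ ≤ 1 / 2)
    (l₁ : -1 ≤ s₁) (l₂ : -1 ≤ t₁) (l₃ : -1 ≤ s₂) (l₄ : -1 ≤ t₂) (l₅ : -1 ≤ s₃) (l₆ : -1 ≤ t₃) : False := by
  have u1 : 0 ≤ 1 / 2 - s₁ := by linarith
  have u2 : 0 ≤ 1 / 2 - t₁ := by linarith
  have u3 : 0 ≤ 1 / 2 - s₂ := by linarith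
  have u4 : 0 ≤ 1 / 2 - t₂ := by linarith
  have u5 : 0 ≤ 1 / 2 - s₃ := by linarith
  have u6 : 0 ≤ 1 / 2 - t₃ := by linarith
  have w1 : 0 ≤ 1 + s₁ := by linarith
  have w2 : 0 ≤ 1 + t₁ := by linarith
  have w3 : 0 ≤ 1 + s₂ := by linarith
  have w4 : 0 ≤ 1 + t₂ := by linarith
  have w5 : 0 ≤ 1 + s₃ := by linarith
  have w6 : 0 ≤ 1 + t₃ := by linarith
  linarith [E1, E3, E4, E5, E6, mul_eq_zero_of_right s₁ E1, mul_eq_zero_of_right t₁ E1, mul_eq_zero_of_right s₂ E1,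
    mul_eq_zero_of_right t₂ E1, mul_eq_zero_of_right s₃ E1, mul_eq_zero_of_right t₃ E1, mul_eq_zero_of_right s₁ E3, mul_eq_zero_of_right t₁ E3, mul_eq_zero_of_right s₂ E3,
    mul_eq_zero_of_right t₂ E3, mul_eq_zero_of_right s₃ E3, mul_eq_zero_of_right t₃ E3, mul_eq_zero_of_right s₁ E4,
    mul_eq_zero_of_right t₁ E4, mul_eq_zero_of_right s₂ E4, mul_eq_zero_of_right t₂ E4, mul_eq_zero_of_right s₃ E4,
    mul_eq_zero_of_right t₃ E4, mul_eq_zero_of_right s₁ E5, mul_eq_zero_of_right t₁ E5, mul_eq_zero_of_right s₂ E5,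
    mul_eq_zero_of_right t₂ E5, mul_eq_zero_of_right s₃ E5, mul_eq_zero_of_right t₃ E5, mul_eq_zero_of_right s₁ E6,
    mul_eq_zero_of_right t₁ E6, mul_eq_zero_of_right s₂ E6, mul_eq_zero_of_right t₂ E6, mul_eq_zero_of_right s₃ E6,
    mul_eq_zero_of_right t₃ E6, mul_nonneg (mul_nonneg u1 w1) u4, mul_nonneg (mul_nonneg u1 w1) u5,
    mul_nonneg (mul_nonneg u1 w1) w6, mul_nonneg (mul_nonneg u1 u2) w4, mul_nonneg (mul_nonneg u1 u2) w6,
    mul_nonneg (mul_nonneg u1 w2) u4, mul_nonneg (mul_nonneg u1 u3) w5, mul_nonneg (mul_nonneg u1 u4) w4,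
    mul_nonneg (mul_nonneg u1 u4) u5, mul_nonneg (mul_nonneg u1 u4) w6, mul_nonneg (mul_nonneg u1 u5) w5,
    mul_nonneg (mul_nonneg u1 u5) w6, mul_nonneg (mul_nonneg w1 u2) u6, mul_nonneg (mul_nonneg w1 u3) u6,
    mul_nonneg (mul_nonneg w1 u4) u6, mul_nonneg (mul_nonneg w1 u6) w6, mul_nonneg (mul_nonneg u2 w2) u3,
    mul_nonneg (mul_nonneg u2 w2) w4, mul_nonneg (mul_nonneg u2 u3) w3, mul_nonneg (mul_nonneg u2 u3) w4,
    mul_nonneg (mul_nonneg u2 u3) w5, mul_nonneg (mul_nonneg u2 u3) u6, mul_nonneg (mul_nonneg u2 w3) u5,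
    mul_nonneg (mul_nonneg u2 w4) u5, mul_nonneg (mul_nonneg u2 u6) w6, mul_nonneg (mul_nonneg w2 u3) u4,
    mul_nonneg (mul_nonneg w2 u4) w4, mul_nonneg (mul_nonneg w2 u4) u5, mul_nonneg (mul_nonneg w2 u4) u6,
    mul_nonneg (mul_nonneg u3 w3) w5, mul_nonneg (mul_nonneg u3 w3) u6, mul_nonneg (mul_nonneg u3 w5) u6,
    mul_nonneg (mul_nonneg w3 u4) u5, mul_nonneg (mul_nonneg w3 u5) w5, mul_nonneg (mul_nonneg w3 u5) u6,
    mul_nonneg (mul_nonneg u4 u5) w5]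

/-- **The prism link is not a contact graph.** A ball `h` touching `a, b, c, a', b', c'` with `a, b, c` mutually touching,
`a', b', c'` mutually touching, `aa'`, `bb'`, `cc'` touching and the six other cross pairs not overlapping: impossible.
[folklore] -/
theorem no_prism_link {h a b c a' b' c' : EuclideanSpace ℝ (Fin 3)} (hha : dist h a = 1) (hhb : dist h b = 1)
    (hhc : dist h c = 1) (hha' : dist h a' = 1) (hhb' : dist h b' = 1) (hhc' : dist h c' = 1) (hab : dist a b = 1)
    (hac : dist a c = 1) (hbc : dist b c = 1) (ha'b' : dist a' b' = 1) (ha'c' : dist a' c' = 1) (hb'c' : dist b' c' = 1)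
    (haa' : dist a a' = 1) (hbb' : dist b b' = 1) (hcc' : dist c c' = 1) (hab' : 1 ≤ dist a b') (hac' : 1 ≤ dist a c')
    (hba' : 1 ≤ dist b a') (hbc' : 1 ≤ dist b c') (hca' : 1 ≤ dist c a') (hcb' : 1 ≤ dist c b') : False := by
  -- Gram data seen from the hub `h`
  have gAA := inner_sub_sub_of_dist h a a
  have gBB := inner_sub_sub_of_dist h b b
  have gCC := inner_sub_sub_of_dist h c c
  have gPP := inner_sub_sub_of_dist h a' a'
  have gQQ := inner_sub_sub_of_dist h b' b'
  have gRR := inner_sub_sub_of_dist h c' c'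
  have gAB := inner_sub_sub_of_dist h a b
  have gAC := inner_sub_sub_of_dist h a c
  have gBC := inner_sub_sub_of_dist h b c
  have gPQ := inner_sub_sub_of_dist h a' b'
  have gPR := inner_sub_sub_of_dist h a' c'
  have gQR := inner_sub_sub_of_dist h b' c'
  have gPA := inner_sub_sub_of_dist h a' a
  have gQB := inner_sub_sub_of_dist h b' b
  have gRC := inner_sub_sub_of_dist h c' c
  have gPB := inner_sub_sub_of_dist h a' b
  have gPC := inner_sub_sub_of_dist h a' c
  have gQA := inner_sub_sub_of_dist h b' a
  have gQC := inner_sub_sub_of_dist h b' c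
  have gRA := inner_sub_sub_of_dist h c' a
  have gRB := inner_sub_sub_of_dist h c' b
  have hab'2 : 1 ≤ dist a b' ^ 2 := one_le_pow₀ hab'
  have hac'2 : 1 ≤ dist a c' ^ 2 := one_le_pow₀ hac'
  have hba'2 : 1 ≤ dist b a' ^ 2 := one_le_pow₀ hba'
  have hbc'2 : 1 ≤ dist b c' ^ 2 := one_le_pow₀ hbc'
  have hca'2 : 1 ≤ dist c a' ^ 2 := one_le_pow₀ hca'
  have hcb'2 : 1 ≤ dist c b' ^ 2 := one_le_pow₀ hcb'
  rw [dist_comm] at hha hhb hhc hha' hhb' hhc' haa' hbb' hcc' hab' hac' hba' hbc' hca' hcb'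
  rw [dist_comm] at hab'2 hac'2 hba'2 hbc'2 hca'2 hcb'2
  rw [hha, hhb, hhc, hha', hhb', hhc', hab, hac, hbc, ha'b', ha'c', hb'c', haa', hbb', hcc', dist_self] at *
  set A := a - h
  set B := b - h
  set C := c - h
  set P := a' - h
  set Q := b' - h
  set R := c' - h
  have g1A : ⟪A, A⟫ = 1 := by rw [gAA]; norm_num
  have g1B : ⟪B, B⟫ = 1 := by rw [gBB]; norm_num
  have g1C : ⟪C, C⟫ = 1 := by rw [gCC]; norm_num
  have hAB : ⟪A, B⟫ = 1 / 2 := by rw [gAB]; norm_num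
  have hAC : ⟪A, C⟫ = 1 / 2 := by rw [gAC]; norm_num
  have hBC : ⟪B, C⟫ = 1 / 2 := by rw [gBC]; norm_num
  have hBA : ⟪B, A⟫ = 1 / 2 := by rw [real_inner_comm, gAB]; norm_num
  have hCA : ⟪C, A⟫ = 1 / 2 := by rw [real_inner_comm, gAC]; norm_num
  have hCB : ⟪C, B⟫ = 1 / 2 := by rw [real_inner_comm, gBC]; norm_num
  have hPA : ⟪P, A⟫ = 1 / 2 := by rw [gPA]; norm_num
  have hQB : ⟪Q, B⟫ = 1 / 2 := by rw [gQB]; norm_num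
  have hRC : ⟪R, C⟫ = 1 / 2 := by rw [gRC]; norm_num
  have hAP : ⟪A, P⟫ = 1 / 2 := by rw [real_inner_comm, gPA]; norm_num
  have hBQ : ⟪B, Q⟫ = 1 / 2 := by rw [real_inner_comm, gQB]; norm_num
  have hCR : ⟪C, R⟫ = 1 / 2 := by rw [real_inner_comm, gRC]; norm_num
  have hBP : ⟪B, P⟫ = ⟪P, B⟫ := real_inner_comm _ _
  have hCP : ⟪C, P⟫ = ⟪P, C⟫ := real_inner_comm _ _
  have hAQ : ⟪A, Q⟫ = ⟪Q, A⟫ := real_inner_comm _ _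
  have hCQ : ⟪C, Q⟫ = ⟪Q, C⟫ := real_inner_comm _ _
  have hAR : ⟪A, R⟫ = ⟪R, A⟫ := real_inner_comm _ _
  have hBR : ⟪B, R⟫ = ⟪R, B⟫ := real_inner_comm _ _
  -- expansions of `P, Q, R` in the tripod basis `A, B, C` (coefficients `G⁻¹ x`)
  have eP : P = (1 - (1 / 2 + ⟪P, B⟫ + ⟪P, C⟫) / 2) • A + (2 * ⟪P, B⟫ - (1 / 2 + ⟪P, B⟫ + ⟪P, C⟫) / 2) • B
      + (2 * ⟪P, C⟫ - (1 / 2 + ⟪P, B⟫ + ⟪P, C⟫) / 2) • C := by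
    have hz := eq_zero_of_inner_tripod g1A g1B g1C hAB hAC hBC
      (w := P - ((1 - (1 / 2 + ⟪P, B⟫ + ⟪P, C⟫) / 2) • A + (2 * ⟪P, B⟫ - (1 / 2 + ⟪P, B⟫ + ⟪P, C⟫) / 2) • B
        + (2 * ⟪P, C⟫ - (1 / 2 + ⟪P, B⟫ + ⟪P, C⟫) / 2) • C)) ?_ ?_ ?_
    · exact sub_eq_zero.1 hz
    · simp only [inner_sub_right, inner_add_right, real_inner_smul_right, hAP, g1A, hAB, hAC]; ring
    · simp only [inner_sub_right, inner_add_right, real_inner_smul_right, hBP, hBA, g1B, hBC]; ring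
    · simp only [inner_sub_right, inner_add_right, real_inner_smul_right, hCP, hCA, hCB, g1C]; ring
  have eQ : Q = (2 * ⟪Q, A⟫ - (⟪Q, A⟫ + 1 / 2 + ⟪Q, C⟫) / 2) • A + (1 - (⟪Q, A⟫ + 1 / 2 + ⟪Q, C⟫) / 2) • B
      + (2 * ⟪Q, C⟫ - (⟪Q, A⟫ + 1 / 2 + ⟪Q, C⟫) / 2) • C := by
    have hz := eq_zero_of_inner_tripod g1A g1B g1C hAB hAC hBC
      (w := Q - ((2 * ⟪Q, A⟫ - (⟪Q, A⟫ + 1 / 2 + ⟪Q, C⟫) / 2) • A + (1 - (⟪Q, A⟫ + 1 / 2 + ⟪Q, C⟫) / 2) • B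
        + (2 * ⟪Q, C⟫ - (⟪Q, A⟫ + 1 / 2 + ⟪Q, C⟫) / 2) • C)) ?_ ?_ ?_
    · exact sub_eq_zero.1 hz
    · simp only [inner_sub_right, inner_add_right, real_inner_smul_right, hAQ, g1A, hAB, hAC]; ring
    · simp only [inner_sub_right, inner_add_right, real_inner_smul_right, hBQ, hBA, g1B, hBC]; ring
    · simp only [inner_sub_right, inner_add_right, real_inner_smul_right, hCQ, hCA, hCB, g1C]; ring
  have eR : R = (2 * ⟪R, A⟫ - (⟪R, A⟫ + ⟪R, B⟫ + 1 / 2) / 2) • A + (2 * ⟪R, B⟫ - (⟪R, A⟫ + ⟪R, B⟫ + 1 / 2) / 2) • B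
      + (1 - (⟪R, A⟫ + ⟪R, B⟫ + 1 / 2) / 2) • C := by
    have hz := eq_zero_of_inner_tripod g1A g1B g1C hAB hAC hBC
      (w := R - ((2 * ⟪R, A⟫ - (⟪R, A⟫ + ⟪R, B⟫ + 1 / 2) / 2) • A + (2 * ⟪R, B⟫ - (⟪R, A⟫ + ⟪R, B⟫ + 1 / 2) / 2) • B
        + (1 - (⟪R, A⟫ + ⟪R, B⟫ + 1 / 2) / 2) • C)) ?_ ?_ ?_
    · exact sub_eq_zero.1 hz
    · simp only [inner_sub_right, inner_add_right, real_inner_smul_right, hAR, g1A, hAB, hAC]; ring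
    · simp only [inner_sub_right, inner_add_right, real_inner_smul_right, hBR, hBA, g1B, hBC]; ring
    · simp only [inner_sub_right, inner_add_right, real_inner_smul_right, hCR, hCA, hCB, g1C]; ring
  -- the six polynomial relations among `s₁ = ⟪P,B⟫, t₁ = ⟪P,C⟫, s₂ = ⟪Q,A⟫, t₂ = ⟪Q,C⟫, s₃ = ⟪R,A⟫, t₃ = ⟪R,B⟫`
  have E1 : 2 * ((1 / 2) ^ 2 + ⟪P, B⟫ ^ 2 + ⟪P, C⟫ ^ 2) - (1 / 2) * (1 / 2 + ⟪P, B⟫ + ⟪P, C⟫) ^ 2 - 1 = 0 := by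
    have e : ⟪P, P⟫ = ⟪P, (1 - (1 / 2 + ⟪P, B⟫ + ⟪P, C⟫) / 2) • A + (2 * ⟪P, B⟫ - (1 / 2 + ⟪P, B⟫ + ⟪P, C⟫) / 2) • B
        + (2 * ⟪P, C⟫ - (1 / 2 + ⟪P, B⟫ + ⟪P, C⟫) / 2) • C⟫ := by rw [← eP]
    simp only [inner_add_right, real_inner_smul_right, hPA] at e
    rw [gPP] at e
    linear_combination -e
  have E3 : 2 * (⟪R, A⟫ ^ 2 + ⟪R, B⟫ ^ 2 + (1 / 2) ^ 2) - (1 / 2) * (⟪R, A⟫ + ⟪R, B⟫ + 1 / 2) ^ 2 - 1 = 0 := by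
    have e : ⟪R, R⟫ = ⟪R, (2 * ⟪R, A⟫ - (⟪R, A⟫ + ⟪R, B⟫ + 1 / 2) / 2) • A + (2 * ⟪R, B⟫ - (⟪R, A⟫ + ⟪R, B⟫ + 1 / 2) / 2) • B
        + (1 - (⟪R, A⟫ + ⟪R, B⟫ + 1 / 2) / 2) • C⟫ := by rw [← eR]
    simp only [inner_add_right, real_inner_smul_right, hRC] at e
    rw [gRR] at e
    linear_combination -e
  have E4 : 2 * (1 / 2 * ⟪Q, A⟫ + ⟪P, B⟫ * (1 / 2) + ⟪P, C⟫ * ⟪Q, C⟫)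
      - (1 / 2) * (1 / 2 + ⟪P, B⟫ + ⟪P, C⟫) * (⟪Q, A⟫ + 1 / 2 + ⟪Q, C⟫) - 1 / 2 = 0 := by
    have e : ⟪P, Q⟫ = ⟪P, (2 * ⟪Q, A⟫ - (⟪Q, A⟫ + 1 / 2 + ⟪Q, C⟫) / 2) • A + (1 - (⟪Q, A⟫ + 1 / 2 + ⟪Q, C⟫) / 2) • B
        + (2 * ⟪Q, C⟫ - (⟪Q, A⟫ + 1 / 2 + ⟪Q, C⟫) / 2) • C⟫ := by rw [← eQ]
    simp only [inner_add_right, real_inner_smul_right, hPA] at e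
    rw [gPQ] at e
    linear_combination -e
  have E5 : 2 * (1 / 2 * ⟪R, A⟫ + ⟪P, B⟫ * ⟪R, B⟫ + ⟪P, C⟫ * (1 / 2))
      - (1 / 2) * (1 / 2 + ⟪P, B⟫ + ⟪P, C⟫) * (⟪R, A⟫ + ⟪R, B⟫ + 1 / 2) - 1 / 2 = 0 := by
    have e : ⟪P, R⟫ = ⟪P, (2 * ⟪R, A⟫ - (⟪R, A⟫ + ⟪R, B⟫ + 1 / 2) / 2) • A + (2 * ⟪R, B⟫ - (⟪R, A⟫ + ⟪R, B⟫ + 1 / 2) / 2) • B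
        + (1 - (⟪R, A⟫ + ⟪R, B⟫ + 1 / 2) / 2) • C⟫ := by rw [← eR]
    simp only [inner_add_right, real_inner_smul_right, hPA] at e
    rw [gPR] at e
    linear_combination -e
  have E6 : 2 * (⟪Q, A⟫ * ⟪R, A⟫ + 1 / 2 * ⟪R, B⟫ + ⟪Q, C⟫ * (1 / 2))
      - (1 / 2) * (⟪Q, A⟫ + 1 / 2 + ⟪Q, C⟫) * (⟪R, A⟫ + ⟪R, B⟫ + 1 / 2) - 1 / 2 = 0 := by
    have e : ⟪Q, R⟫ = ⟪Q, (2 * ⟪R, A⟫ - (⟪R, A⟫ + ⟪R, B⟫ + 1 / 2) / 2) • A + (2 * ⟪R, B⟫ - (⟪R, A⟫ + ⟪R, B⟫ + 1 / 2) / 2) • B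
        + (1 - (⟪R, A⟫ + ⟪R, B⟫ + 1 / 2) / 2) • C⟫ := by rw [← eR]
    simp only [inner_add_right, real_inner_smul_right, hQB] at e
    rw [gQR] at e
    linear_combination -e
  -- lower bounds `−1 ≤ ⟪·,·⟫` for unit vectors (from `0 ≤ ‖u + v‖²`)
  have lPB : -1 ≤ ⟪P, B⟫ := by
    have h0 : 0 ≤ ⟪P + B, P + B⟫ := real_inner_self_nonneg
    simp only [inner_add_left, inner_add_right, hBP] at h0
    linarith only [h0, gPP, g1B]
  have lPC : -1 ≤ ⟪P, C⟫ := by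
    have h0 : 0 ≤ ⟪P + C, P + C⟫ := real_inner_self_nonneg
    simp only [inner_add_left, inner_add_right, hCP] at h0
    linarith only [h0, gPP, g1C]
  have lQA : -1 ≤ ⟪Q, A⟫ := by
    have h0 : 0 ≤ ⟪Q + A, Q + A⟫ := real_inner_self_nonneg
    simp only [inner_add_left, inner_add_right, hAQ] at h0
    linarith only [h0, gQQ, g1A]
  have lQC : -1 ≤ ⟪Q, C⟫ := by
    have h0 : 0 ≤ ⟪Q + C, Q + C⟫ := real_inner_self_nonneg
    simp only [inner_add_left, inner_add_right, hCQ] at h0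
    linarith only [h0, gQQ, g1C]
  have lRA : -1 ≤ ⟪R, A⟫ := by
    have h0 : 0 ≤ ⟪R + A, R + A⟫ := real_inner_self_nonneg
    simp only [inner_add_left, inner_add_right, hAR] at h0
    linarith only [h0, gRR, g1A]
  have lRB : -1 ≤ ⟪R, B⟫ := by
    have h0 : 0 ≤ ⟪R + B, R + B⟫ := real_inner_self_nonneg
    simp only [inner_add_left, inner_add_right, hBR] at h0
    linarith only [h0, gRR, g1B]
  exact prism_algebra ⟪P, B⟫ ⟪P, C⟫ ⟪Q, A⟫ ⟪Q, C⟫ ⟪R, A⟫ ⟪R, B⟫ E1 E3 E4 E5 E6 (by linarith only [gPB, hba'2])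
    (by linarith only [gPC, hca'2]) (by linarith only [gQA, hab'2]) (by linarith only [gQC, hcb'2])
    (by linarith only [gRA, hac'2]) (by linarith only [gRB, hbc'2]) lPB lPC lQA lQC lRA lRB

end Summit.Ventures.Crystal3D

end
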